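import Summits.Ventures.LatticeQCDFlow.Exactness.ReversiblePairSums
import Summits.Ventures.LatticeQCDFlow.Exactness.Phi4MetropolisPolyObsDCT
import Summits.Ventures.LatticeQCDFlow.Exactness.Phi4HMCPolyObsFloor
import Summits.Ventures.LatticeQCDFlow.Exactness.Phi4FlowCrossObservableFloor
import HarnessLib

/-!
# Geyer's pair sums for ALL THREE calibration arms: nonincreasing `Γ_m`, odd windows are floors of `τ_int`, and the pair decay `(N+1)(ρ(2N) + ρ(2N+1)) ≤ τ_int + ½`

HONEST FRAMING: exact (Metropolis-corrected) sampling algorithms for lattice gauge theory;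
figures of merit are autocorrelation/cost numbers at stated couplings and volumes; no
continuum-physics claim.  (SCALAR calibration rung S0-A: not a gauge result.)

Venture `LatticeQCDFlow` (cell pub-lqcd), topic `Exactness`; FANOUT row 2 (`s0-phi4`: the three S0-A
arms — random-site Metropolis `metroScan`, HMC `hmcOpPhi4` of every step size and trajectory
length, the flow sampler `imhOpPhi4` with any positive model density).  NEW WORK of the cell: the
lattice instances of `Exactness/ReversiblePairSums.lean` (Geyer 1992 Thm 3.1 typed without the
spectral theorem for every reversible exact sampler in the `RevOp` format).  No positivity is
needed, so the HMC arm — which has no `L²` spectral gap at fixed step size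
(`Exactness/Phi4HMCNoSpectralGap.lean`) and is not a positive operator — is covered.  Nothing is
cited as a fact.  Printed counterpart NAMED ONLY: Geyer 1992, Statist. Sci. 7, Thm 3.1 / §3.3.

## What is proved (`g = f − ⟨f⟩`, `C(k) = ∫ g (Kᵏ g) e^{−S}`, `ρ(k) = C(k)/C(0)`,
`Γ_m = C(2m) + C(2m+1)`; "summable" = the tree's standing hypothesis on the normalised series)

* LOCAL arm (coercive action, any even step law with all moments, `f ∈ PolyObs`):
  `metropolisScan_pairSum_succ_le` (`Γ_{m+1} ≤ Γ_m`, unconditional) and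
  **`metropolisScan_oddWindow_le_and_pairDecay`** (summable ⇒ `τ_{2N+1} ≤ τ_int` for every `N` and
  `(N+1)(ρ(2N) + ρ(2N+1)) ≤ τ_int + ½`);
* HMC arm (every `λ > 0`, real `J`, EVERY `δ` and `N`, `f ∈ PolyObs`): `hmcPhi4_pairSum_succ_le`,
  **`hmcPhi4_oddWindow_le_and_pairDecay`**;
* FLOW arm (every `λ > 0`, real `J`, every positive model density `q̃`, bounded measurable `g`):
  **`phi4Flow_oddWindow_le_and_pairDecay`** (general measurable space first:
  `imhOp_oddWindow_le_and_pairDecay`).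

Reading for the scorers (no numerics implied): for all three arms an automatic-windowing estimate of
`τ_int` closed after an odd lag is, on the true autocorrelation function, a FLOOR; and a measured
pair `ρ̂(2N) + ρ̂(2N+1)` that stays above `(τ + ½)/(N+1)` is inconsistent with the claimed `τ`.
NOT CLAIMED: estimator statistics; summability for any run; the ordered sweep.
-/

namespace Summit.Ventures.LatticeQCDFlow.Exactness

open Real MeasureTheory Filter Finset Topology
open Summit.Ventures.LatticeQCDFlow.Scoring

/-! ## §1 The flow sampler on a general space (bounded observables) -/

section General

variable {X : Type*} [MeasurableSpace X] {μ : Measure X} [SFinite μ] {w q : X → ℝ}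

/-- **FLOW SAMPLER, general space**: for bounded measurable `g` with a summable normalised series,
every odd window is a floor of `τ_int` and `(N+1)(ρ(2N) + ρ(2N+1)) ≤ τ_int + ½`. -/
theorem imhOp_oddWindow_le_and_pairDecay (hw0 : ∀ t, 0 < w t) (hwm : Measurable w)
    (hwi : Integrable w μ) (hq0 : ∀ t, 0 < q t) (hqm : Measurable q) (hqi : Integrable q μ)
    (hq1 : ∫ t, q t ∂μ = 1) {g : X → ℝ} (hgm : Measurable g) {Bg : ℝ} (hgb : ∀ t, |g t| ≤ Bg)
    (hs : Summable fun k => (∫ t, g t * ((imhOp μ w q)^[k + 1] g) t * w t ∂μ)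
      / ∫ t, g t ^ 2 * w t ∂μ) (N : ℕ) :
    tauIntWindow (fun k => (∫ t, g t * ((imhOp μ w q)^[k] g) t * w t ∂μ) / ∫ t, g t ^ 2 * w t ∂μ)
        (2 * N + 1)
      ≤ tauInt (fun k => (∫ t, g t * ((imhOp μ w q)^[k] g) t * w t ∂μ) / ∫ t, g t ^ 2 * w t ∂μ) ∧
    ((N : ℝ) + 1) * ((∫ t, g t * ((imhOp μ w q)^[2 * N] g) t * w t ∂μ) / (∫ t, g t ^ 2 * w t ∂μ)
        + (∫ t, g t * ((imhOp μ w q)^[2 * N + 1] g) t * w t ∂μ) / (∫ t, g t ^ 2 * w t ∂μ))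
      ≤ tauInt (fun k => (∫ t, g t * ((imhOp μ w q)^[k] g) t * w t ∂μ) / ∫ t, g t ^ 2 * w t ∂μ)
        + 1 / 2 := by
  have hAi : ∀ ⦃f h : X → ℝ⦄, (Measurable f ∧ ∃ B : ℝ, ∀ t, |f t| ≤ B) →
      (Measurable h ∧ ∃ B : ℝ, ∀ t, |h t| ≤ B) → Integrable (fun x => f x * h x * w x) μ := by
    intro f h hf hh
    obtain ⟨hfm', Bf, hfb'⟩ := hf
    obtain ⟨hhm', Bh, hhb'⟩ := hh
    exact integrable_mul_mul_weight hw0 hwm hwi hfm' hhm' hfb' hhb'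
  have hAc : ∀ ⦃f h : X → ℝ⦄ (l : ℝ), (Measurable f ∧ ∃ B : ℝ, ∀ t, |f t| ≤ B) →
      (Measurable h ∧ ∃ B : ℝ, ∀ t, |h t| ≤ B) →
      (Measurable (fun x => f x + l * h x) ∧ ∃ B : ℝ, ∀ t, |f t + l * h t| ≤ B) := by
    intro f h l hf hh
    obtain ⟨hfm', Bf, hfb'⟩ := hf
    obtain ⟨hhm', Bh, hhb'⟩ := hh
    refine ⟨hfm'.add (measurable_const.mul hhm'), Bf + |l| * Bh, fun t => ?_⟩
    calc |f t + l * h t| ≤ |f t| + |l * h t| := abs_add_le _ _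
      _ ≤ Bf + |l| * Bh := by
          rw [abs_mul]; exact add_le_add (hfb' t) (mul_le_mul_of_nonneg_left (hhb' t) (abs_nonneg _))
  have hAK : ∀ ⦃f : X → ℝ⦄, (Measurable f ∧ ∃ B : ℝ, ∀ t, |f t| ≤ B) →
      (Measurable (imhOp μ w q f) ∧ ∃ B : ℝ, ∀ t, |imhOp μ w q f t| ≤ B) := by
    intro f hf
    obtain ⟨hfm', Bf, hfb'⟩ := hf
    exact ⟨measurable_imhOp hwm hqm hfm', Bf, imhOp_abs_le hw0 hq0 hqi hq1 hfb'⟩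
  have hlin : ∀ ⦃f h : X → ℝ⦄ (l : ℝ), (Measurable f ∧ ∃ B : ℝ, ∀ t, |f t| ≤ B) →
      (Measurable h ∧ ∃ B : ℝ, ∀ t, |h t| ≤ B) →
      ∀ t, imhOp μ w q (fun s => f s + l * h s) t = imhOp μ w q f t + l * imhOp μ w q h t := by
    intro f h l hf hh t
    obtain ⟨hfm', Bf, hfb'⟩ := hf
    obtain ⟨hhm', Bh, hhb'⟩ := hh
    exact imhOp_add_mul hw0 hwm hq0 hqm hqi hfm' hhm' hfb' hhb' l t
  have hsymm : ∀ ⦃f h : X → ℝ⦄, (Measurable f ∧ ∃ B : ℝ, ∀ t, |f t| ≤ B) →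
      (Measurable h ∧ ∃ B : ℝ, ∀ t, |h t| ≤ B) →
      ∫ x, imhOp μ w q f x * h x * w x ∂μ = ∫ x, f x * imhOp μ w q h x * w x ∂μ := by
    intro f h hf hh
    obtain ⟨hfm', Bf, hfb'⟩ := hf
    obtain ⟨hhm', Bh, hhb'⟩ := hh
    exact integral_imhOp_mul_mul_comm hw0 hwm hwi hq0 hqm hqi hfm' hhm' hfb' hhb'
  have hcontr : ∀ ⦃f : X → ℝ⦄, (Measurable f ∧ ∃ B : ℝ, ∀ t, |f t| ≤ B) →
      ∫ x, imhOp μ w q f x ^ 2 * w x ∂μ ≤ ∫ x, f x ^ 2 * w x ∂μ := by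
    intro f hf
    obtain ⟨hfm', Bf, hfb'⟩ := hf
    exact integral_imhOp_sq_le_integral_sq hw0 hwm hwi hq0 hqm hqi hq1 hfm' hfb'
  exact ⟨RevOp.tauIntWindow_odd_le_tauInt (μ := μ)
      (A := fun f : X → ℝ => Measurable f ∧ ∃ B : ℝ, ∀ t, |f t| ≤ B) (K := imhOp μ w q) (w := w)
      (fun t => (hw0 t).le) hAi hAK hsymm hcontr ⟨hgm, Bg, hgb⟩ hs N,
    RevOp.succ_mul_pairSum_le_tauInt (μ := μ)
      (A := fun f : X → ℝ => Measurable f ∧ ∃ B : ℝ, ∀ t, |f t| ≤ B) (K := imhOp μ w q) (w := w)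
      (fun t => (hw0 t).le) hAi hAc hAK hlin hsymm hcontr ⟨hgm, Bg, hgb⟩ hs N⟩

end General

section Lattice

variable {n : ℕ}

/-- `f − c ∈ PolyObs` (local copy of `polyObs_sub_const` from `Phi4HMCPolyObsFloor`). -/
private theorem polyObs_sub_const₃ {f : (Fin (n + 1) → ℝ) → ℝ} (hf : PolyObs f) (c : ℝ) :
    PolyObs (fun φ => f φ - c) := by
  have h := polyObs_add_mul hf (polyObs_const 1) (-c)
  have e : (fun φ => f φ + -c * (1 : ℝ)) = fun φ => f φ - c := funext fun φ => by ring
  rw [e] at h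
  exact h

/-! ## §2 The local arm -/

/-- **LOCAL ARM, nonincreasing pair sums** (unconditional): coercive action, even step law with all
moments, `f ∈ PolyObs`, `g = f − ⟨f⟩`:  `C(2m+2) + C(2m+3) ≤ C(2m) + C(2m+1)`. -/
theorem metropolisScan_pairSum_succ_le {J : Fin (n + 1) → Fin (n + 1) → ℝ} {lam ε K : ℝ}
    (hε : 0 < ε) (hS : ∀ φ : Fin (n + 1) → ℝ, ε * ∑ w, φ w ^ 2 - K ≤ latticePhi4Action J lam φ)
    {ρ : ℝ → ℝ} (hρ0 : ∀ u, 0 ≤ ρ u) (hρm : Measurable ρ) (hρi : Integrable ρ)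
    (hρ1 : ∫ u, ρ u = 1) (hρs : ∀ u, ρ (-u) = ρ u)
    (hρmom : ∀ j : ℕ, Integrable (fun u => (1 + |u|) ^ j * ρ u))
    {f : (Fin (n + 1) → ℝ) → ℝ} (hf : PolyObs f) (m : ℕ) :
    (∫ φ, (f φ - gibbsExpect J lam f)
        * ((metroScan J lam ρ)^[2 * m + 2] (fun ψ => f ψ - gibbsExpect J lam f)) φ
        * gibbsWeight J lam φ)
      + ∫ φ, (f φ - gibbsExpect J lam f)
        * ((metroScan J lam ρ)^[2 * m + 3] (fun ψ => f ψ - gibbsExpect J lam f)) φ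
        * gibbsWeight J lam φ
      ≤ (∫ φ, (f φ - gibbsExpect J lam f)
        * ((metroScan J lam ρ)^[2 * m] (fun ψ => f ψ - gibbsExpect J lam f)) φ
        * gibbsWeight J lam φ)
      + ∫ φ, (f φ - gibbsExpect J lam f)
        * ((metroScan J lam ρ)^[2 * m + 1] (fun ψ => f ψ - gibbsExpect J lam f)) φ
        * gibbsWeight J lam φ := by
  have hg : PolyObs (fun ψ => f ψ - gibbsExpect J lam f) := polyObs_sub_const₃ hf _
  exact RevOp.pairSum_succ_le (μ := volume) (A := PolyObs) (K := metroScan J lam ρ)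
    (w := gibbsWeight J lam) (fun φ => (gibbsWeight_pos J lam φ).le)
    (fun f h hf hh => polyObs_integrable_mul_mul_gibbsWeight hε hS hf hh)
    (fun f h c hf hh => polyObs_add_mul hf hh c)
    (fun f hf => polyObs_metroScan J lam hρ0 hρm hρmom hf)
    (fun f h c hf hh x => metroScan_add_mul_poly J lam hρ0 hρm hρmom hf hh c x)
    (fun f h hf hh => metroScan_reversible_poly hε hS hρ0 hρm hρi hρ1 hρs hρmom hf hh)
    (fun f hf => metroScan_contraction_poly hε hS hρ0 hρm hρi hρ1 hρs hρmom hf) hg m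

/-- **LOCAL ARM, odd windows are floors and pairs decay**: with a summable normalised series,
`τ_{2N+1} ≤ τ_int` for every `N` and `(N+1)(ρ(2N) + ρ(2N+1)) ≤ τ_int + ½`. -/
theorem metropolisScan_oddWindow_le_and_pairDecay {J : Fin (n + 1) → Fin (n + 1) → ℝ} {lam ε K : ℝ}
    (hε : 0 < ε) (hS : ∀ φ : Fin (n + 1) → ℝ, ε * ∑ w, φ w ^ 2 - K ≤ latticePhi4Action J lam φ)
    {ρ : ℝ → ℝ} (hρ0 : ∀ u, 0 ≤ ρ u) (hρm : Measurable ρ) (hρi : Integrable ρ)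
    (hρ1 : ∫ u, ρ u = 1) (hρs : ∀ u, ρ (-u) = ρ u)
    (hρmom : ∀ j : ℕ, Integrable (fun u => (1 + |u|) ^ j * ρ u))
    {f : (Fin (n + 1) → ℝ) → ℝ} (hf : PolyObs f)
    (hs : Summable fun k => (∫ φ, (f φ - gibbsExpect J lam f)
        * ((metroScan J lam ρ)^[k + 1] (fun ψ => f ψ - gibbsExpect J lam f)) φ * gibbsWeight J lam φ)
        / ∫ φ, (f φ - gibbsExpect J lam f) ^ 2 * gibbsWeight J lam φ) (N : ℕ) :
    tauIntWindow (fun k => (∫ φ, (f φ - gibbsExpect J lam f)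
        * ((metroScan J lam ρ)^[k] (fun ψ => f ψ - gibbsExpect J lam f)) φ * gibbsWeight J lam φ)
        / ∫ φ, (f φ - gibbsExpect J lam f) ^ 2 * gibbsWeight J lam φ) (2 * N + 1)
      ≤ tauInt (fun k => (∫ φ, (f φ - gibbsExpect J lam f)
        * ((metroScan J lam ρ)^[k] (fun ψ => f ψ - gibbsExpect J lam f)) φ * gibbsWeight J lam φ)
        / ∫ φ, (f φ - gibbsExpect J lam f) ^ 2 * gibbsWeight J lam φ) ∧
    ((N : ℝ) + 1) * ((∫ φ, (f φ - gibbsExpect J lam f)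
        * ((metroScan J lam ρ)^[2 * N] (fun ψ => f ψ - gibbsExpect J lam f)) φ * gibbsWeight J lam φ)
        / (∫ φ, (f φ - gibbsExpect J lam f) ^ 2 * gibbsWeight J lam φ)
      + (∫ φ, (f φ - gibbsExpect J lam f)
        * ((metroScan J lam ρ)^[2 * N + 1] (fun ψ => f ψ - gibbsExpect J lam f)) φ
        * gibbsWeight J lam φ)
        / (∫ φ, (f φ - gibbsExpect J lam f) ^ 2 * gibbsWeight J lam φ))
      ≤ tauInt (fun k => (∫ φ, (f φ - gibbsExpect J lam f)
        * ((metroScan J lam ρ)^[k] (fun ψ => f ψ - gibbsExpect J lam f)) φ * gibbsWeight J lam φ)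
        / ∫ φ, (f φ - gibbsExpect J lam f) ^ 2 * gibbsWeight J lam φ) + 1 / 2 := by
  have hg : PolyObs (fun ψ => f ψ - gibbsExpect J lam f) := polyObs_sub_const₃ hf _
  exact ⟨RevOp.tauIntWindow_odd_le_tauInt (μ := volume) (A := PolyObs) (K := metroScan J lam ρ)
      (w := gibbsWeight J lam) (fun φ => (gibbsWeight_pos J lam φ).le)
      (fun f h hf hh => polyObs_integrable_mul_mul_gibbsWeight hε hS hf hh)
      (fun f hf => polyObs_metroScan J lam hρ0 hρm hρmom hf)
      (fun f h hf hh => metroScan_reversible_poly hε hS hρ0 hρm hρi hρ1 hρs hρmom hf hh)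
      (fun f hf => metroScan_contraction_poly hε hS hρ0 hρm hρi hρ1 hρs hρmom hf) hg hs N,
    RevOp.succ_mul_pairSum_le_tauInt (μ := volume) (A := PolyObs) (K := metroScan J lam ρ)
      (w := gibbsWeight J lam) (fun φ => (gibbsWeight_pos J lam φ).le)
      (fun f h hf hh => polyObs_integrable_mul_mul_gibbsWeight hε hS hf hh)
      (fun f h c hf hh => polyObs_add_mul hf hh c)
      (fun f hf => polyObs_metroScan J lam hρ0 hρm hρmom hf)
      (fun f h c hf hh x => metroScan_add_mul_poly J lam hρ0 hρm hρmom hf hh c x)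
      (fun f h hf hh => metroScan_reversible_poly hε hS hρ0 hρm hρi hρ1 hρs hρmom hf hh)
      (fun f hf => metroScan_contraction_poly hε hS hρ0 hρm hρi hρ1 hρs hρmom hf) hg hs N⟩

/-! ## §3 The HMC arm (every step size and trajectory length) -/

/-- **HMC ARM, nonincreasing pair sums** (unconditional): every `λ > 0`, real `J`, every `δ`, `N`,
`f ∈ PolyObs`, `g = f − ⟨f⟩`:  `C(2m+2) + C(2m+3) ≤ C(2m) + C(2m+1)`. -/
theorem hmcPhi4_pairSum_succ_le {lam : ℝ} (hlam : 0 < lam) (J : Fin (n + 1) → Fin (n + 1) → ℝ)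
    (δ : ℝ) (N : ℕ) {f : (Fin (n + 1) → ℝ) → ℝ} (hf : PolyObs f) (m : ℕ) :
    (∫ φ, (f φ - gibbsExpect J lam f)
        * ((hmcOpPhi4 J lam δ N)^[2 * m + 2] (fun ψ => f ψ - gibbsExpect J lam f)) φ
        * gibbsWeight J lam φ)
      + ∫ φ, (f φ - gibbsExpect J lam f)
        * ((hmcOpPhi4 J lam δ N)^[2 * m + 3] (fun ψ => f ψ - gibbsExpect J lam f)) φ
        * gibbsWeight J lam φ
      ≤ (∫ φ, (f φ - gibbsExpect J lam f)
        * ((hmcOpPhi4 J lam δ N)^[2 * m] (fun ψ => f ψ - gibbsExpect J lam f)) φ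
        * gibbsWeight J lam φ)
      + ∫ φ, (f φ - gibbsExpect J lam f)
        * ((hmcOpPhi4 J lam δ N)^[2 * m + 1] (fun ψ => f ψ - gibbsExpect J lam f)) φ
        * gibbsWeight J lam φ := by
  have hco := latticePhi4Action_coercive hlam J
  obtain ⟨C, hC1, hCg⟩ := hmcProposal_growth J lam δ N
  have hC : 0 ≤ C := zero_le_one.trans hC1
  have hΨm := measurable_hmcProposal (Λ := Fin (n + 1)) J lam δ N
  have hΨi := hmcProposal_involutive (Λ := Fin (n + 1)) J lam δ N
  have hΨμ := measurePreserving_hmcProposal (Λ := Fin (n + 1)) J lam δ N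
  have hg : PolyObs (fun ψ => f ψ - gibbsExpect J lam f) := polyObs_sub_const₃ hf _
  exact RevOp.pairSum_succ_le (μ := volume) (A := PolyObs)
    (K := hmcOpOf J lam (hmcProposal J lam δ N)) (w := gibbsWeight J lam)
    (fun φ => (gibbsWeight_pos J lam φ).le)
    (fun f h hf hh => polyObs_integrable_mul_mul_gibbsWeight one_pos hco hf hh)
    (fun f h c hf hh => polyObs_add_mul hf hh c)
    (fun f hf => polyObs_hmcOpOf J lam hΨm hC hCg hf)
    (fun f h c hf hh x => hmcOpOf_add_mul_poly J lam hΨm hC hCg hf hh c x)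
    (fun f h hf hh => hmc_reversible_poly one_pos hco hΨm hΨi hΨμ hf hh)
    (fun f hf => hmcOpOf_contraction_poly one_pos hco hΨm hΨi hΨμ hC hCg hf) hg m

/-- **HMC ARM, odd windows are floors and pairs decay**: every `λ > 0`, real `J`, every `δ`, `N`,
`f ∈ PolyObs` with a summable normalised series under `hmcOpPhi4 J λ δ N`:
`τ_{2M+1} ≤ τ_int` for every `M` and `(M+1)(ρ(2M) + ρ(2M+1)) ≤ τ_int + ½`. -/
theorem hmcPhi4_oddWindow_le_and_pairDecay {lam : ℝ} (hlam : 0 < lam)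
    (J : Fin (n + 1) → Fin (n + 1) → ℝ) (δ : ℝ) (N : ℕ) {f : (Fin (n + 1) → ℝ) → ℝ} (hf : PolyObs f)
    (hs : Summable fun k => (∫ φ, (f φ - gibbsExpect J lam f)
        * ((hmcOpPhi4 J lam δ N)^[k + 1] (fun ψ => f ψ - gibbsExpect J lam f)) φ
        * gibbsWeight J lam φ) / ∫ φ, (f φ - gibbsExpect J lam f) ^ 2 * gibbsWeight J lam φ)
    (M : ℕ) :
    tauIntWindow (fun k => (∫ φ, (f φ - gibbsExpect J lam f)
        * ((hmcOpPhi4 J lam δ N)^[k] (fun ψ => f ψ - gibbsExpect J lam f)) φ * gibbsWeight J lam φ)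
        / ∫ φ, (f φ - gibbsExpect J lam f) ^ 2 * gibbsWeight J lam φ) (2 * M + 1)
      ≤ tauInt (fun k => (∫ φ, (f φ - gibbsExpect J lam f)
        * ((hmcOpPhi4 J lam δ N)^[k] (fun ψ => f ψ - gibbsExpect J lam f)) φ * gibbsWeight J lam φ)
        / ∫ φ, (f φ - gibbsExpect J lam f) ^ 2 * gibbsWeight J lam φ) ∧
    ((M : ℝ) + 1) * ((∫ φ, (f φ - gibbsExpect J lam f)
        * ((hmcOpPhi4 J lam δ N)^[2 * M] (fun ψ => f ψ - gibbsExpect J lam f)) φ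
        * gibbsWeight J lam φ) / (∫ φ, (f φ - gibbsExpect J lam f) ^ 2 * gibbsWeight J lam φ)
      + (∫ φ, (f φ - gibbsExpect J lam f)
        * ((hmcOpPhi4 J lam δ N)^[2 * M + 1] (fun ψ => f ψ - gibbsExpect J lam f)) φ
        * gibbsWeight J lam φ) / (∫ φ, (f φ - gibbsExpect J lam f) ^ 2 * gibbsWeight J lam φ))
      ≤ tauInt (fun k => (∫ φ, (f φ - gibbsExpect J lam f)
        * ((hmcOpPhi4 J lam δ N)^[k] (fun ψ => f ψ - gibbsExpect J lam f)) φ * gibbsWeight J lam φ)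
        / ∫ φ, (f φ - gibbsExpect J lam f) ^ 2 * gibbsWeight J lam φ) + 1 / 2 := by
  have hco := latticePhi4Action_coercive hlam J
  obtain ⟨C, hC1, hCg⟩ := hmcProposal_growth J lam δ N
  have hC : 0 ≤ C := zero_le_one.trans hC1
  have hΨm := measurable_hmcProposal (Λ := Fin (n + 1)) J lam δ N
  have hΨi := hmcProposal_involutive (Λ := Fin (n + 1)) J lam δ N
  have hΨμ := measurePreserving_hmcProposal (Λ := Fin (n + 1)) J lam δ N
  have hg : PolyObs (fun ψ => f ψ - gibbsExpect J lam f) := polyObs_sub_const₃ hf _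
  exact ⟨RevOp.tauIntWindow_odd_le_tauInt (μ := volume) (A := PolyObs)
      (K := hmcOpOf J lam (hmcProposal J lam δ N)) (w := gibbsWeight J lam)
      (fun φ => (gibbsWeight_pos J lam φ).le)
      (fun f h hf hh => polyObs_integrable_mul_mul_gibbsWeight one_pos hco hf hh)
      (fun f hf => polyObs_hmcOpOf J lam hΨm hC hCg hf)
      (fun f h hf hh => hmc_reversible_poly one_pos hco hΨm hΨi hΨμ hf hh)
      (fun f hf => hmcOpOf_contraction_poly one_pos hco hΨm hΨi hΨμ hC hCg hf) hg hs M,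
    RevOp.succ_mul_pairSum_le_tauInt (μ := volume) (A := PolyObs)
      (K := hmcOpOf J lam (hmcProposal J lam δ N)) (w := gibbsWeight J lam)
      (fun φ => (gibbsWeight_pos J lam φ).le)
      (fun f h hf hh => polyObs_integrable_mul_mul_gibbsWeight one_pos hco hf hh)
      (fun f h c hf hh => polyObs_add_mul hf hh c)
      (fun f hf => polyObs_hmcOpOf J lam hΨm hC hCg hf)
      (fun f h c hf hh x => hmcOpOf_add_mul_poly J lam hΨm hC hCg hf hh c x)
      (fun f h hf hh => hmc_reversible_poly one_pos hco hΨm hΨi hΨμ hf hh)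
      (fun f hf => hmcOpOf_contraction_poly one_pos hco hΨm hΨi hΨμ hC hCg hf) hg hs M⟩

/-! ## §4 The flow arm -/

/-- **FLOW ARM, odd windows are floors and pairs decay**: every `λ > 0`, real `J`, positive measurable
model density `q̃` with `∫ q̃ = 1`, bounded measurable `g` with a summable normalised series under
`imhOpPhi4 J λ q̃`:  `τ_{2N+1} ≤ τ_int` and `(N+1)(ρ(2N) + ρ(2N+1)) ≤ τ_int + ½`. -/
theorem phi4Flow_oddWindow_le_and_pairDecay {lam : ℝ} (hlam : 0 < lam)
    (J : Fin (n + 1) → Fin (n + 1) → ℝ) {q : (Fin (n + 1) → ℝ) → ℝ} (hq0 : ∀ φ, 0 < q φ)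
    (hqm : Measurable q) (hqi : Integrable q) (hq1 : ∫ φ, q φ = 1)
    {g : (Fin (n + 1) → ℝ) → ℝ} (hg : BddObs g)
    (hs : Summable fun k => (∫ φ, g φ * ((imhOpPhi4 J lam q)^[k + 1] g) φ * gibbsWeight J lam φ)
        / ∫ φ, g φ ^ 2 * gibbsWeight J lam φ) (N : ℕ) :
    tauIntWindow (fun k => (∫ φ, g φ * ((imhOpPhi4 J lam q)^[k] g) φ * gibbsWeight J lam φ)
        / ∫ φ, g φ ^ 2 * gibbsWeight J lam φ) (2 * N + 1)
      ≤ tauInt (fun k => (∫ φ, g φ * ((imhOpPhi4 J lam q)^[k] g) φ * gibbsWeight J lam φ)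
        / ∫ φ, g φ ^ 2 * gibbsWeight J lam φ) ∧
    ((N : ℝ) + 1) * ((∫ φ, g φ * ((imhOpPhi4 J lam q)^[2 * N] g) φ * gibbsWeight J lam φ)
        / (∫ φ, g φ ^ 2 * gibbsWeight J lam φ)
      + (∫ φ, g φ * ((imhOpPhi4 J lam q)^[2 * N + 1] g) φ * gibbsWeight J lam φ)
        / (∫ φ, g φ ^ 2 * gibbsWeight J lam φ))
      ≤ tauInt (fun k => (∫ φ, g φ * ((imhOpPhi4 J lam q)^[k] g) φ * gibbsWeight J lam φ)
        / ∫ φ, g φ ^ 2 * gibbsWeight J lam φ) + 1 / 2 := by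
  have hwi := integrable_gibbsWeight hlam J
  have hw0 : ∀ φ : Fin (n + 1) → ℝ, 0 < gibbsWeight J lam φ := fun φ => gibbsWeight_pos J lam φ
  have hwm : Measurable (gibbsWeight J lam) := (continuous_gibbsWeight J lam).measurable
  obtain ⟨hgm, Bg, hgb⟩ := hg
  rw [imhOpPhi4_eq_imhOp] at hs ⊢
  exact imhOp_oddWindow_le_and_pairDecay (μ := volume) hw0 hwm hwi hq0 hqm hqi hq1 hgm hgb hs N

end Lattice

end Summit.Ventures.LatticeQCDFlow.Exactness
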